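import Literature.NumberTheory.Automorphic.ZariskiGLProducts
import HarnessLib

/-!
# Groups generated by closed connected subgroups (Springer 2.2.6, 2.2.7 (i))
(trunk T-AUTOMORPHIC, G25 AutomorphicL)

Companion to `ZariskiGL.lean`, `ZariskiAffineSpace.lean` and `ZariskiGLProducts.lean` (namespace
`Literature.Automorphic`, concrete `k`-points vocabulary: algebraic subgroups of `GL n k` are the
Zariski-closed ones, `IsAlgebraicSubgroup ↔ IsClosed`; connected means `IsZConnected`, equivalently
closed and irreducible, Springer 2.2.1). Main result:

* **`isZConnected_iSup`** — Springer, *Linear Algebraic Groups*, Cor. 2.2.7 (i): *if `(G_i)` is a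
  family of closed connected subgroups, the subgroup `H` generated by them is closed and
  connected* (over an algebraically closed field `k`; `H = ⨆ i, G i` in `Subgroup (GL n k)`).
  This strengthens the closure forms `isZConnected_zariskiClosure_sup` /
  `isZConnected_zariskiClosure_iSup` of `ZariskiGL.lean` (connectedness of the *smallest
  algebraic* subgroup containing the `G_i`, over any field): the new content is that the
  abstractly generated subgroup is already closed;
  with the second clause `H = G_{a(1)} ⋯ G_{a(m)}` (`exists_coe_iSup_eq_prodList`); corollaries
  `isAlgebraicSubgroup_iSup`, `isZConnected_sup`, `isZConnected_iSup_prop`.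

The proof is Springer's (2.2.6): the finite products `Y_l = G_{l₁} ⋯ G_{lₘ}` (`prodList`) are
irreducible (`isIrreducible_prodList`) and exhaust `H` (`coe_iSup_eq_iUnion_prodList`); a maximal
closure `Ȳ_{l₀}` exists (`exists_maximal_of_isClosed_of_isIrreducible`: vanishing ideals of
irreducible closed sets are primes of finite height in `k[x_{ij}, det⁻¹]`, Springer 1.8.2 in the
guise of `ZariskiGL.lean`)
and is then the closure of `H`; by Chevalley's theorem 1.9.5
(`exists_isOpen_inter_closure_image_subset_of_isIrreducible` of `ZariskiAffineSpace.lean`,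
applied inductively to the multiplication maps `G_i × O → GL n`,
`exists_isOpen_inter_closure_prodList`) `Y_{l₀}` contains
a non-empty open subset of `Ȳ_{l₀}`, so `H` is closed by 2.2.4 (ii)
(`isClosed_of_isOpen_inter_closure`) and irreducible, i.e. connected (2.2.1,
`isZConnected_of_isIrreducible`); and by 2.2.3 `H = Y_{l₀} Y_{l₀}` is itself a finite product
(`exists_coe_iSup_eq_prodList`, the second clause of 2.2.7 (i)).

## References

* T. A. Springer, *Linear Algebraic Groups*, 2nd ed., Progress in Mathematics 9, Birkhäuser
  (1998), 1.8.2, 1.9.5, 2.2.1, 2.2.3, 2.2.4, 2.2.6, 2.2.7 (i).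
-/

noncomputable section

open scoped MatrixGroups Pointwise
open Topology

namespace Literature.NumberTheory.Automorphic

variable {k : Type*} [Field k] {n : Type*} [Fintype n] [DecidableEq n]

/-!
### Groups generated by closed connected subgroups (Springer 2.2.6, 2.2.7 (i))
-/

section Generation

attribute [local instance] zariskiTopologyPi zariskiTopologyGL

variable {ι : Type*} (G : ι → Subgroup (GL n k))

/-- The finite products `Y_l = G_{l₁} ⋯ G_{lₘ} ⊆ GL n k` attached to a family of subgroups
(Springer 2.2.6, proof: the sets `Y_a`): the product, in the pointwise monoid `Set (GL n k)`, of the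
list of the underlying sets (`List.prod`; so `Y_[] = {1}`, `Y_{i :: l} = G_i · Y_l`,
`Y_{l₁ ++ l₂} = Y_{l₁} Y_{l₂}` are Mathlib's `List.prod_nil`, `List.prod_cons`, `List.prod_append`).
[folklore] -/
abbrev prodList (l : List ι) : Set (GL n k) :=
  (l.map fun i => (G i : Set (GL n k))).prod

/-- `1 ∈ Y_l`. [folklore] -/
lemma one_mem_prodList (l : List ι) : (1 : GL n k) ∈ prodList G l := by
  induction l with
  | nil => exact Set.one_mem_one
  | cons i l ih =>
    rw [prodList, List.map_cons, List.prod_cons]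
    exact ⟨1, (G i).one_mem, 1, ih, mul_one 1⟩

/-- `Y_{l₁ ++ l₂} = Y_{l₁} Y_{l₂}` (`List.prod_append`). [folklore] -/
lemma prodList_append (l₁ l₂ : List ι) :
    prodList G (l₁ ++ l₂) = prodList G l₁ * prodList G l₂ := by
  rw [prodList, List.map_append, List.prod_append]

/-- `Y_l⁻¹ = Y_{l reversed}` (the `G_i` are subgroups). [folklore] -/
lemma inv_prodList (l : List ι) : (prodList G l)⁻¹ = prodList G l.reverse := by
  induction l with
  | nil => simp [prodList]
  | cons i l ih =>
    rw [prodList, List.map_cons, List.prod_cons, mul_inv_rev, ← prodList, ih, inv_coe_set,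
      List.reverse_cons, prodList_append]
    simp [prodList]

/-- `Y_l` lies in the subgroup generated by the `G_i`. [folklore] -/
lemma prodList_subset_iSup (l : List ι) :
    prodList G l ⊆ ((⨆ i, G i : Subgroup (GL n k)) : Set (GL n k)) := by
  induction l with
  | nil => exact Set.one_subset.2 (⨆ i, G i).one_mem
  | cons i l ih =>
    rw [prodList, List.map_cons, List.prod_cons]
    rintro _ ⟨g, hg, h, hh, rfl⟩
    exact (⨆ i, G i).mul_mem (Subgroup.mem_iSup_of_mem i hg) (ih hh)

/-- The subgroup generated by the `G_i` is the union of the finite products `Y_l`. [folklore] -/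
theorem coe_iSup_eq_iUnion_prodList :
    ((⨆ i, G i : Subgroup (GL n k)) : Set (GL n k)) = ⋃ l, prodList G l := by
  refine Set.Subset.antisymm ?_ (Set.iUnion_subset (prodList_subset_iSup G))
  -- the union is a subgroup containing every `G_i`
  let K : Subgroup (GL n k) :=
    { carrier := ⋃ l, prodList G l
      one_mem' := Set.mem_iUnion.2 ⟨[], one_mem_prodList G []⟩
      mul_mem' := fun {a b} ha hb => by
        obtain ⟨l₁, h₁⟩ := Set.mem_iUnion.1 ha
        obtain ⟨l₂, h₂⟩ := Set.mem_iUnion.1 hb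
        exact Set.mem_iUnion.2 ⟨l₁ ++ l₂, by rw [prodList_append]; exact Set.mul_mem_mul h₁ h₂⟩
      inv_mem' := fun {a} ha => by
        obtain ⟨l, h⟩ := Set.mem_iUnion.1 ha
        exact Set.mem_iUnion.2 ⟨l.reverse, by rw [← inv_prodList]; exact Set.inv_mem_inv.2 h⟩ }
  change ((⨆ i, G i : Subgroup (GL n k)) : Set (GL n k)) ⊆ (K : Set (GL n k))
  exact SetLike.coe_subset_coe.2
    (iSup_le fun i g hg => Set.mem_iUnion.2 ⟨[i], by simpa [prodList] using hg⟩)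

/-- The `Y_l` are irreducible if the `G_i` are (Springer 2.2.6: `Y_a` is irreducible).
[folklore] -/
theorem isIrreducible_prodList (hG : ∀ i, IsIrreducible (G i : Set (GL n k))) (l : List ι) :
    IsIrreducible (prodList G l) := by
  induction l with
  | nil =>
    rw [show prodList G [] = ({1} : Set (GL n k)) from Set.singleton_one.symm]
    exact isIrreducible_singleton
  | cons i l ih =>
    rw [prodList, List.map_cons, List.prod_cons]
    exact isIrreducible_mul (hG i) ih

/-- `closure Y_{l₁} · closure Y_{l₂} ⊆ closure Y_{l₁ ++ l₂}` (Springer 2.2.6: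
`Ȳ_b Ȳ_c ⊆ Ȳ_{(b, c)}`). [folklore] -/
lemma closure_prodList_mul_subset (l₁ l₂ : List ι) :
    closure (prodList G l₁) * closure (prodList G l₂) ⊆ closure (prodList G (l₁ ++ l₂)) := by
  rw [prodList_append]
  exact closure_mul_closure_subset _ _

/-- **Among any non-empty family of irreducible closed subsets of `GL n k` there is a maximal
one** with respect to inclusion (the finiteness of dimension, Springer 1.8.1–1.8.2, in the guise
of `ZariskiGL.lean`: vanishing ideals of irreducible closed sets are primes of the
finite-dimensional ring `k[x_{ij}, det⁻¹]`, and strictly larger sets have primes of strictly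
smaller height). This is the set-level form of `IsZConnected.primePoint` /
`height_primePoint_lt_top` / `primeHeight_lt_of_lt` of `ZariskiGL.lean` (the subgroup versions
could be derived from it). [folklore] -/
theorem exists_maximal_of_isClosed_of_isIrreducible {α : Type*} [Nonempty α] (F : α → Set (GL n k))
    (hirr : ∀ a, IsIrreducible (F a)) (hcl : ∀ a, IsClosed (F a)) :
    ∃ a, ∀ b, F a ⊆ F b → F a = F b := by
  classical
  -- the prime points and their (finite) heights
  let pt : α → PrimeSpectrum (MvPolynomial (GLCoord n) k) := fun a =>
    ⟨MvPolynomial.vanishingIdeal k (glCoordFun '' F a),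
      isPrime_vanishingIdeal_of_isIrreducible (hirr a)⟩
  have hfin : ∀ a, Order.height (pt a) < ⊤ := fun a => by
    have h1 := Order.height_le_krullDim (pt a)
    have h2 : Order.krullDim (PrimeSpectrum (MvPolynomial (GLCoord n) k)) =
        (Nat.card (GLCoord n) : WithBot ℕ∞) := ringKrullDim_mvPolynomial_glCoord
    rw [h2] at h1
    have h3 : Order.height (pt a) ≤ (Nat.card (GLCoord n) : ℕ∞) := by exact_mod_cast h1
    exact lt_of_le_of_lt h3 (ENat.coe_lt_top _)
  let h : α → ℕ := fun a => (Order.height (pt a)).toNat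
  -- strictly larger closed irreducible sets have strictly smaller height
  have hlt : ∀ a b, F a ⊂ F b → h b < h a := by
    intro a b hab
    have hpt : pt b < pt a := by
      rw [← PrimeSpectrum.asIdeal_lt_asIdeal]
      refine lt_of_le_of_ne (MvPolynomial.vanishingIdeal_anti_mono (Set.image_mono hab.le)) ?_
      intro hEq
      obtain ⟨S, hS⟩ := isClosed_zariski_iff.1 (hcl a)
      obtain ⟨S', hS'⟩ := isClosed_zariski_iff.1 (hcl b)
      exact hab.ne (eq_of_vanishingIdeal_eq hS hS' hEq.symm)
    have := Order.height_strictMono hpt (hfin b)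
    change (Order.height (pt b)).toNat < (Order.height (pt a)).toNat
    have e := ENat.coe_toNat (hfin a).ne
    have e' := ENat.coe_toNat (hfin b).ne
    rw [← e, ← e'] at this
    exact_mod_cast this
  -- a member of minimal height is maximal
  have hex : ∃ m, ∃ a, h a = m := ⟨_, Classical.arbitrary α, rfl⟩
  obtain ⟨a, ha⟩ := Nat.find_spec hex
  refine ⟨a, fun b hab => ?_⟩
  by_contra hne
  have h1 : h b < h a := hlt a b (Set.ssubset_iff_subset_ne.2 ⟨hab, hne⟩)
  have h2 : Nat.find hex ≤ h b := Nat.find_min' hex ⟨b, rfl⟩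
  omega

/-- A family of connected subgroups indexed by a proposition has connected supremum (a convenience
for nested `⨆`; trivial: the supremum is a member or `⊥`). [folklore] -/
theorem isZConnected_iSup_prop {p : Prop} {f : p → Subgroup (GL n k)}
    (hf : ∀ h, IsZConnected (f h)) :
    IsZConnected (⨆ h, f h) := by
  by_cases hp : p
  · rw [iSup_pos hp]; exact hf hp
  · rw [iSup_neg hp]; exact isZConnected_bot

variable [IsAlgClosed k]

/-- **The key step of Springer 2.2.6, via Chevalley's theorem 1.9.5**: each finite product
`Y_l = G_{l₁} ⋯ G_{lₘ}` of irreducible closed subgroups contains a non-empty relatively open subset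
of its closure. By induction on `l`, using the points form of Chevalley's theorem
(`exists_isOpen_inter_closure_image_subset_of_isIrreducible`) for the multiplication map on
`G_i × O`, `O` the
relatively open part of `Y_l` already found, read in affine coordinates (`prodSet`,
`image_mulPolyGL_prodSet`). [cite: SpringerLAG1998, 2.2.6 (proof) and 1.9.5] -/
theorem exists_isOpen_inter_closure_prodList (halg : ∀ i, IsAlgebraicSubgroup (G i))
    (hirr : ∀ i, IsIrreducible (G i : Set (GL n k))) (l : List ι) :
    ∃ U : Set (GL n k), IsOpen U ∧ (U ∩ closure (prodList G l)).Nonempty ∧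
      U ∩ closure (prodList G l) ⊆ prodList G l := by
  induction l with
  | nil =>
    refine ⟨Set.univ, isOpen_univ, ?_, ?_⟩
    · exact ⟨1, Set.mem_univ _, subset_closure rfl⟩
    · rw [show prodList G [] = ({1} : Set (GL n k)) from Set.singleton_one.symm,
        (isClosed_singleton_zariski (1 : GL n k)).closure_eq]
      exact Set.inter_subset_right
  | cons i l ih =>
    obtain ⟨U, hU, hne, hUsub⟩ := ih
    -- `Z = closure Y_l`, `O = U ∩ Z`
    set Z : Set (GL n k) := closure (prodList G l) with hZ
    have hZirr : IsIrreducible Z := (isIrreducible_prodList G hirr l).closure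
    set O : Set (GL n k) := U ∩ Z with hO
    have hOirr : IsIrreducible O := isIrreducible_isOpen_inter hZirr hU hne
    have hOsub : O ⊆ prodList G l := hUsub
    have hZO : Z ⊆ closure O := by
      rw [hO, Set.inter_comm]
      exact subset_closure_inter_of_isPreirreducible_of_isOpen hZirr.2 hU
        (by rw [Set.inter_comm]; exact hne)
    -- in coordinates: `V = G_i × O ⊆ k^{ρ ⊕ ρ}` is irreducible and locally closed
    have hcemb := isClosedEmbedding_glCoordFun (n := n) (k := k)
    obtain ⟨U', hU', hUU'⟩ := isInducing_glCoordFun.isOpen_iff.1 hU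
    have hglO : glCoordFun '' O = U' ∩ glCoordFun '' Z := by
      rw [hO, ← hUU', Set.image_preimage_inter]
    have hOlc : IsLocallyClosed (glCoordFun '' O) := by
      rw [hglO]
      exact hU'.isLocallyClosed.inter (hcemb.isClosedMap _ isClosed_closure).isLocallyClosed
    have hGlc : IsLocallyClosed (glCoordFun '' (G i : Set (GL n k))) :=
      (hcemb.isClosedMap _ (halg i).isClosed).isLocallyClosed
    have hVlc : IsLocallyClosed (prodSet (glCoordFun '' (G i : Set (GL n k))) (glCoordFun '' O)) :=
      isLocallyClosed_prodSet hGlc hOlc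
    have hVirr : IsIrreducible (prodSet (glCoordFun '' (G i : Set (GL n k))) (glCoordFun '' O)) :=
      isIrreducible_prodSet (isIrreducible_image_glCoordFun (hirr i))
        (isIrreducible_image_glCoordFun hOirr)
    -- Chevalley for the multiplication map
    obtain ⟨W, hW, hWne, hWsub⟩ :=
      exists_isOpen_inter_closure_image_subset_of_isIrreducible hVlc hVirr mulPolyGL
      (φ := fun (v : GLCoord n ⊕ GLCoord n → k) (c : GLCoord n) =>
        MvPolynomial.eval v (mulPolyGL c))
      (fun _ _ => rfl)
    rw [image_mulPolyGL_prodSet, hcemb.closure_image_eq] at hWne hWsub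
    -- `closure (G_i O) = closure Y_{i :: l}`
    have hcons : prodList G (i :: l) = (G i : Set (GL n k)) * prodList G l := by
      rw [prodList, List.map_cons, List.prod_cons]
    have hcl : closure ((G i : Set (GL n k)) * O) = closure (prodList G (i :: l)) := by
      rw [hcons]
      refine Set.Subset.antisymm (closure_mono (Set.mul_subset_mul_left hOsub)) ?_
      refine closure_minimal ?_ isClosed_closure
      calc (G i : Set (GL n k)) * prodList G l
          ⊆ closure (G i : Set (GL n k)) * closure O :=
            Set.mul_subset_mul subset_closure (subset_closure.trans hZO)
        _ ⊆ closure ((G i : Set (GL n k)) * O) := closure_mul_closure_subset _ _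
    refine ⟨glCoordFun ⁻¹' W, hW.preimage continuous_glCoordFun, ?_, ?_⟩
    · obtain ⟨_, hwW, ⟨g, hg, rfl⟩⟩ := hWne
      exact ⟨g, hwW, by rw [← hcl]; exact hg⟩
    · rintro g ⟨hgW, hgcl⟩
      rw [← hcl] at hgcl
      obtain ⟨g', hg', hgg'⟩ := hWsub ⟨hgW, ⟨g, hgcl, rfl⟩⟩
      rw [← glCoordFun_injective hgg', hcons]
      exact Set.mul_subset_mul_left hOsub hg'

/-- The core of Springer 2.2.6: for a family of closed connected subgroups `G_i` generating `H`,
some finite product `Y_{l₀}` has closure `closure H` and contains a non-empty relatively open subset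
of it. [cite: SpringerLAG1998, Prop 2.2.6 (proof)] -/
theorem exists_prodList_closure_eq (hG : ∀ i, IsZConnected (G i)) [Nonempty ι] :
    ∃ (l₀ : List ι) (U : Set (GL n k)), IsOpen U ∧
      (U ∩ closure ((⨆ i, G i : Subgroup (GL n k)) : Set (GL n k))).Nonempty ∧
      U ∩ closure ((⨆ i, G i : Subgroup (GL n k)) : Set (GL n k)) ⊆ prodList G l₀ ∧
      closure ((⨆ i, G i : Subgroup (GL n k)) : Set (GL n k)) = closure (prodList G l₀) := by
  have halg : ∀ i, IsAlgebraicSubgroup (G i) := fun i => (hG i).1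
  have hirr : ∀ i, IsIrreducible (G i : Set (GL n k)) := fun i => (hG i).isIrreducible
  set H : Subgroup (GL n k) := ⨆ i, G i with hH
  -- a maximal closure `F l₀` of the `Y_l`
  let F : List ι → Set (GL n k) := fun l => closure (prodList G l)
  obtain ⟨l₀, hl₀⟩ := exists_maximal_of_isClosed_of_isIrreducible F
    (fun l => (isIrreducible_prodList G hirr l).closure) fun l => isClosed_closure
  have hFle : ∀ l, F l ⊆ F l₀ := by
    intro l
    have h1 : F l₀ ⊆ F (l₀ ++ l) := closure_mono fun g hg => by
      rw [prodList_append]; exact ⟨g, hg, 1, one_mem_prodList G l, mul_one g⟩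
    have h2 : F l ⊆ F (l₀ ++ l) := closure_mono fun g hg => by
      rw [prodList_append]; exact ⟨1, one_mem_prodList G l₀, g, hg, one_mul g⟩
    rwa [← hl₀ _ h1] at h2
  -- `closure H = F l₀`
  have hclH : closure (H : Set (GL n k)) = F l₀ := by
    refine Set.Subset.antisymm (closure_minimal ?_ isClosed_closure)
      (closure_mono (prodList_subset_iSup G l₀))
    rw [hH, coe_iSup_eq_iUnion_prodList]
    exact Set.iUnion_subset fun l => subset_closure.trans (hFle l)
  obtain ⟨U, hU, hne, hUsub⟩ := exists_isOpen_inter_closure_prodList G halg hirr l₀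
  refine ⟨l₀, U, hU, ?_, ?_, hclH⟩
  · rwa [hclH]
  · rw [hclH]; exact hUsub

/-- **Springer 2.2.7 (i): the subgroup generated by a family of closed connected subgroups of
`GL n k` is closed and connected** (over an algebraically closed field; generation as an abstract
group, `⨆ i, G i` in the lattice of subgroups). Printed proof (2.2.6): among the closures of the
finite products `Y_l = G_{l₁} ⋯ G_{lₘ}` take a maximal one, `Ȳ`; it contains all `Y_l`, so it is the
closure of the generated group `H`, and `Y_l ⊇` a non-empty open subset of `Ȳ` (1.9.5), whence `H`
is closed (2.2.4 (ii)), and irreducible, i.e. connected (2.2.1). The second clause of 2.2.7 (i),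
`H = G_{a(1)} ⋯ G_{a(n)}`, is `exists_coe_iSup_eq_prodList`.
[cite: SpringerLAG1998, Cor 2.2.7 (i)] -/
theorem isZConnected_iSup (hG : ∀ i, IsZConnected (G i)) : IsZConnected (⨆ i, G i) := by
  rcases isEmpty_or_nonempty ι with hι | hι
  · rw [iSup_of_empty]; exact isZConnected_bot
  have hirr : ∀ i, IsIrreducible (G i : Set (GL n k)) := fun i => (hG i).isIrreducible
  obtain ⟨l₀, U, hU, hne, hUsub, hclH⟩ := exists_prodList_closure_eq G hG
  -- `H` contains a non-empty open subset of its closure, hence is closed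
  have hHcl : IsClosed ((⨆ i, G i : Subgroup (GL n k)) : Set (GL n k)) :=
    isClosed_of_isOpen_inter_closure _ hU hne (hUsub.trans (prodList_subset_iSup G l₀))
  -- and irreducible
  refine isZConnected_of_isIrreducible (isAlgebraicSubgroup_iff_isClosed.2 hHcl) ?_
  rw [← hHcl.closure_eq, hclH]
  exact (isIrreducible_prodList G hirr l₀).closure

/-- **Springer 2.2.7 (i), second clause: the generated subgroup is a finite product,
`H = G_{a(1)} ⋯ G_{a(m)}`** for suitable indices. As printed (2.2.6 with 2.2.3): `Y_{l₀}` contains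
a non-empty open subset `O` of the irreducible group `H = Ȳ_{l₀}`, and `O · O = H` since for
`x ∈ H` the non-empty open subsets `x O⁻¹` and `O` of `H` meet; so `H = Y_{l₀} Y_{l₀} = Y_{l₀ l₀}`.
[cite: SpringerLAG1998, Cor 2.2.7 (i) with Lemma 2.2.3] -/
theorem exists_coe_iSup_eq_prodList (hG : ∀ i, IsZConnected (G i)) :
    ∃ l : List ι, ((⨆ i, G i : Subgroup (GL n k)) : Set (GL n k)) = prodList G l := by
  rcases isEmpty_or_nonempty ι with hι | hι
  · exact ⟨[], by rw [iSup_of_empty, Subgroup.coe_bot]; exact Set.singleton_one⟩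
  have hconn := isZConnected_iSup G hG
  set H : Subgroup (GL n k) := ⨆ i, G i with hH
  have hHcl : IsClosed (H : Set (GL n k)) := hconn.1.isClosed
  have hHirr : IsIrreducible (H : Set (GL n k)) := hconn.isIrreducible
  obtain ⟨l₀, U, hU, hne, hUsub, -⟩ := exists_prodList_closure_eq G hG
  rw [hHcl.closure_eq] at hne hUsub
  refine ⟨l₀ ++ l₀, Set.Subset.antisymm ?_ (prodList_subset_iSup G _)⟩
  rw [prodList_append]
  intro x hx
  -- the open sets `x • (U ∩ H)⁻¹ = x U⁻¹ ∩ H` and `U ∩ H` of the irreducible `H` meet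
  have hopen : IsOpen (x • U⁻¹) := by
    rw [← image_zariskiMulLeft, ← image_zariskiInv]
    exact (zariskiMulLeft x).isOpenMap _ (zariskiInv.isOpenMap _ hU)
  obtain ⟨o, hoU, hoH⟩ := hne
  have hne' : ((H : Set (GL n k)) ∩ (x • U⁻¹)).Nonempty :=
    ⟨x * o⁻¹, H.mul_mem hx (H.inv_mem hoH), o⁻¹, Set.inv_mem_inv.2 (by simpa using hoU), rfl⟩
  obtain ⟨y, hyH, ⟨u, hu, rfl⟩, hyU⟩ := hHirr.2 (x • U⁻¹) U hopen hU hne' ⟨o, hoH, hoU⟩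
  -- `y = x u` with `u⁻¹ ∈ U ∩ H`, `y ∈ U ∩ H`; so `x = y · u⁻¹ ∈ Y Y`
  have hu' : u⁻¹ ∈ U := by simpa using hu
  have huH : u⁻¹ ∈ H := by
    have : x⁻¹ * (x • u) ∈ H := H.mul_mem (H.inv_mem hx) hyH
    simpa using H.inv_mem this
  refine ⟨x • u, hUsub ⟨hyU, hyH⟩, u⁻¹, hUsub ⟨hu', huH⟩, ?_⟩
  simp [smul_eq_mul, mul_assoc]

/-- Springer 2.2.7 (i), closedness clause: the subgroup generated by a family of closed connected
subgroups of `GL n k` is algebraic (over an algebraically closed field).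
[cite: SpringerLAG1998, Cor 2.2.7 (i)] -/
theorem isAlgebraicSubgroup_iSup (hG : ∀ i, IsZConnected (G i)) : IsAlgebraicSubgroup (⨆ i, G i) :=
  (isZConnected_iSup G hG).1

variable {G}

/-- Springer 2.2.7 (i) for two subgroups: `H₁ ⊔ H₂` is closed and connected if `H₁`, `H₂` are.
[cite: SpringerLAG1998, Cor 2.2.7 (i)] -/
theorem isZConnected_sup {H₁ H₂ : Subgroup (GL n k)} (h₁ : IsZConnected H₁) (h₂ : IsZConnected H₂) :
    IsZConnected (H₁ ⊔ H₂) := by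
  rw [sup_eq_iSup]
  exact isZConnected_iSup _ fun b => by cases b <;> assumption

end Generation

end Literature.NumberTheory.Automorphic
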